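import Literature.Analysis.FluidPDE.PassiveVectorGalerkin
import Literature.Analysis.FluidPDE.NSHopfLimit
import Literature.Analysis.FluidPDE.TransportGalerkinLimit
import Literature.Analysis.FunctionSpaces.DiagonalWeakLimits
import Literature.Analysis.FunctionSpaces.TorusSpaceTimeFields
import Literature.Analysis.FunctionSpaces.TorusVectorParseval
import HarnessLib

/-!
# The Fourier–Galerkin scheme for the passive solenoidal vector (`A = 0`) with a trigonometric-polynomial
  carrier, II: truncation, uniform bounds, diagonal extraction, the limit field

Analysis/FluidPDE proof-support file (definitions with bodies + theorems; no named facts), sequel of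
`PassiveVectorGalerkin`. For a carrier `b(t) = realTrigPoly B (β t)` — a continuous curve of real
divergence-free vector trigonometric polynomials with frequencies in a finite symmetric set `B` and
uniformly bounded coefficients (`Torus.TrigPolyCarrier`) — a viscosity `κ ≥ 0`, a frequency set `Sec`
stable under translation by `B` (a Bloch sector), and an `L²` weakly divergence-free datum `w₀` with
vanishing mean mode supported in `Sec` (`Torus.PVSetup`), this file runs Hopf's compactness method
(Hopf 1951, §4; Robinson–Rodrigo–Sadowski 2016, Thm. 4.4 Step 3 and Thm. 4.11; the scalar model is the
tree's `TransportGalerkinScheme` / `TransportGalerkinLimit`):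

* §1 the Galerkin approximations of order `N` (`PVSetup.galerkinCoeff`: the solution of the truncated
  system on `freqBall N` in the sector phase space, `PassiveVectorGalerkin.exists_pvGalerkin_solution`),
  their uniform coefficient-energy bound `∑_k ‖α_N t k‖² ≤ ∫‖w₀‖²` (Bessel) and the sector-Poincaré decay;
* §2 the equi-Lipschitz estimate of every Fourier mode in time (per-mode bound of the truncated transport
  term, `norm_convectionCoeff_apply_le_of_support`);
* §3 the diagonal extraction: along a subsequence every mode converges at every `t ≥ 0`
  (`exists_subseq_tendsto_galerkinCoeffAt`), the limits being conjugate symmetric, transversal, supported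
  in `Sec ∖ {0}`, with the finite energy bounds and the decay;
* §4 the limit field `w` with `𝓕(complexify ∘ w t) = c t` for every `t ≥ 0`
  (`TorusSpaceTimeFields.exists_realField_forall_mFourierCoeff_eq`), packaged as `PVSetup.IsGalerkinLimit`,
  and its first properties (`L²` bound, decay, sector support, weak divergence-freeness of every slice).

The weak formulation of the limit is the object of the sequel.

## References

* E. Hopf, Math. Nachr. 4 (1951) 213–231, §4. [`Hopf1951`]
* J. C. Robinson, J. L. Rodrigo, W. Sadowski, *The three-dimensional Navier–Stokes equations*
  (CUP 2016), Thm. 4.4 Step 3, Thm. 4.11, Exercises 4.2–4.9. [`RobinsonRodrigoSadowski2016`]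
* K. Yoshida, Y. Kaneda, Phys. Rev. E 63 (2000) 016308, §II eq. (4)–(5). [`YoshidaKaneda2000`]
-/

open MeasureTheory Set Filter Topology UnitAddTorus Metric Function
open scoped ENNReal NNReal InnerProductSpace

noncomputable section

namespace Literature.Analysis.FluidPDE

namespace Torus

open FunctionSpaces.Torus FunctionSpaces

variable {d : Type*} [Fintype d] [DecidableEq d]

/-! ## §0 Standing hypotheses -/

section Setup

/-- **A trigonometric-polynomial carrier**: `b t = realTrigPoly B (β t)` for a finite symmetric frequency
set `B`, the coefficients `β t` being supported in `B`, conjugate symmetric (real field), transversal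
(divergence free), uniformly bounded by `C`, and continuous in `t` — the lattice-shear-word cell carriers
of `LatticeShearWords` are of this form (each layer a single real Fourier mode under a continuous
envelope). [cite: RobinsonRodrigoSadowski2016, Thm. 4.4 Step 1 (4.5)] -/
structure TrigPolyCarrier (b : ℝ → UnitAddTorus d → EuclideanSpace ℝ d) (B : Finset (d → ℤ))
    (β : ℝ → (d → ℤ) → EuclideanSpace ℂ d) (C : ℝ) : Prop where
  symm : ∀ k ∈ B, -k ∈ B
  eq : ∀ t, b t = realTrigPoly B (β t)
  support : ∀ t, ∀ k ∉ B, β t k = 0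
  conjSymm : ∀ t, IsConjSymm (β t)
  transversal : ∀ t k, ∑ j, (k j : ℂ) * β t k j = 0
  norm_le : ∀ t k, ‖β t k‖ ≤ C
  continuous : ∀ k, Continuous fun t => β t k

variable {b : ℝ → UnitAddTorus d → EuclideanSpace ℝ d} {B : Finset (d → ℤ)}
  {β : ℝ → (d → ℤ) → EuclideanSpace ℂ d} {C κ : ℝ} {Sec : Set (d → ℤ)}
  {w₀ : UnitAddTorus d → EuclideanSpace ℝ d}

omit [DecidableEq d] in
/-- The bound of a trigonometric-polynomial carrier is nonnegative (when `B` is non-empty; in general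
`max C 0` is a bound, so we record `0 ≤ max C 0`). [cite: RobinsonRodrigoSadowski2016, Thm. 4.4 Step 1 (4.5)] -/
theorem TrigPolyCarrier.norm_le_max (h : TrigPolyCarrier b B β C) (t : ℝ) (k : d → ℤ) :
    ‖β t k‖ ≤ max C 0 :=
  (h.norm_le t k).trans (le_max_left _ _)

/-- **The data of the scheme**: viscosity `κ ≥ 0`, a trigonometric-polynomial carrier, a frequency set
`Sec` stable under translation by the carrier frequencies, and a datum `w₀ ∈ L²(T^d; ℝ^d)`, weakly
divergence free, with vanishing mean mode and Fourier support in `Sec`. [cite: RobinsonRodrigoSadowski2016, Thm. 4.4] -/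
structure PVSetup (κ : ℝ) (b : ℝ → UnitAddTorus d → EuclideanSpace ℝ d) (B : Finset (d → ℤ))
    (β : ℝ → (d → ℤ) → EuclideanSpace ℂ d) (C : ℝ) (Sec : Set (d → ℤ))
    (w₀ : UnitAddTorus d → EuclideanSpace ℝ d) : Prop where
  nonneg : 0 ≤ κ
  carrier : TrigPolyCarrier b B β C
  sector : ∀ k l, l ∈ B → k - l ∈ Sec → k ∈ Sec
  memLp : MemLp w₀ 2 volume
  divFree : FunctionSpaces.Torus.IsWeaklyDivFree w₀
  coeff_zero : mFourierCoeff (EuclideanSpace.complexify ∘ w₀) 0 = 0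
  coeff_support : ∀ k, k ∉ Sec → mFourierCoeff (EuclideanSpace.complexify ∘ w₀) k = 0

end Setup

/-! ## §1 The Galerkin approximations of order `N` -/

section Scheme

variable {b : ℝ → UnitAddTorus d → EuclideanSpace ℝ d} {B : Finset (d → ℤ)}
  {β : ℝ → (d → ℤ) → EuclideanSpace ℂ d} {C κ : ℝ} {Sec : Set (d → ℤ)}
  {w₀ : UnitAddTorus d → EuclideanSpace ℝ d}

/-- The carrier coefficients restricted to the Galerkin set `freqBall N`. [cite: RobinsonRodrigoSadowski2016, Thm. 4.4 Step 1 (4.5)] -/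
def carrierTrunc (β : ℝ → (d → ℤ) → EuclideanSpace ℂ d) (N : ℕ) (t : ℝ) :
    ↥(freqBall (d := d) N) → EuclideanSpace ℂ d :=
  fun k => β t k

/-- The datum coefficients restricted to the Galerkin set `freqBall N` (`P_N w₀` in coordinates). [cite: RobinsonRodrigoSadowski2016, Thm. 4.4 Step 1 (4.3)] -/
def datumTrunc (w₀ : UnitAddTorus d → EuclideanSpace ℝ d) (N : ℕ) :
    ↥(freqBall (d := d) N) → EuclideanSpace ℂ d :=
  fun k => mFourierCoeff (EuclideanSpace.complexify ∘ w₀) k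

/-- The truncated carrier curve is continuous. [cite: RobinsonRodrigoSadowski2016, Thm. 4.4 Step 1 (4.5)] -/
theorem continuous_carrierTrunc (h : TrigPolyCarrier b B β C) (N : ℕ) :
    Continuous (carrierTrunc β N) :=
  continuous_pi fun k => h.continuous k

/-- The truncated carrier coefficients are real. [cite: ConstantinFoias1988, Ch. 8 (8.3)–(8.5)] -/
theorem isRealCoeff_carrierTrunc (h : TrigPolyCarrier b B β C) (N : ℕ) (t : ℝ) :
    IsRealCoeff (carrierTrunc β N t) :=
  isRealCoeff_restrict (h.conjSymm t)

/-- The truncated carrier coefficients are transversal. [cite: ConstantinFoias1988, Ch. 8 (8.3)–(8.5)] -/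
theorem isSolenoidalCoeff_carrierTrunc (h : TrigPolyCarrier b B β C) (N : ℕ) (t : ℝ) :
    IsSolenoidalCoeff (carrierTrunc β N t) :=
  fun k => h.transversal t k

/-- Sup-norm bound of the truncated carrier coefficients. [cite: RobinsonRodrigoSadowski2016, Thm. 4.4 Step 1 (4.5)] -/
theorem norm_carrierTrunc_le (h : TrigPolyCarrier b B β C) (N : ℕ) (t : ℝ) :
    ‖carrierTrunc β N t‖ ≤ max C 0 :=
  (pi_norm_le_iff_of_nonneg (le_max_right _ _)).2 fun k => h.norm_le_max t k

/-- The extension of the truncated carrier vanishes off `B`. [cite: RobinsonRodrigoSadowski2016, Thm. 4.4 Step 1 (4.5)] -/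
theorem coeffExt_carrierTrunc_eq_zero (h : TrigPolyCarrier b B β C) (N : ℕ) (t : ℝ) {l : d → ℤ}
    (hl : l ∉ B) : coeffExt (freqBall N) (carrierTrunc β N t) l = 0 := by
  by_cases hlS : l ∈ freqBall N
  · rw [coeffExt_of_mem _ hlS]; exact h.support t l hl
  · exact coeffExt_of_not_mem _ hlS

/-- **The truncated datum lies in the sector phase space** (real, transversal, supported in `Sec`, zero
mode zero). [cite: ConstantinFoias1988, Ch. 8 (8.3)–(8.5)] -/
theorem datumTrunc_mem_pvPhase (h : PVSetup κ b B β C Sec w₀) (N : ℕ) :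
    datumTrunc w₀ N ∈ pvPhase (freqBall N) Sec := by
  refine ⟨⟨isRealCoeff_mFourierCoeff (h.memLp.integrable one_le_two),
    isSolenoidalCoeff_restrict (h.divFree.isTransversal_mFourierCoeff h.memLp (freqBall N))⟩, ?_⟩
  rintro k (hk | hk)
  · exact h.coeff_support k hk
  · simp only [datumTrunc, hk]; exact h.coeff_zero

/-- **The Galerkin coefficient curve of order `N`**: the solution of the truncated passive-vector system
on `freqBall N` from the truncated datum, valued in the sector phase space, with non-increasing energy
(chosen by `exists_pvGalerkin_solution`). [cite: RobinsonRodrigoSadowski2016, Thm. 4.4 Steps 1–2] -/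
def PVSetup.galerkinCoeff (h : PVSetup κ b B β C Sec w₀) (N : ℕ) : ℝ → ↥(freqBall (d := d) N) → EuclideanSpace ℂ d :=
  (exists_pvGalerkin_solution κ h.nonneg (neg_mem_freqBall_of_mem (N := N))
    (continuous_carrierTrunc h.carrier N) (isRealCoeff_carrierTrunc h.carrier N)
    (isSolenoidalCoeff_carrierTrunc h.carrier N) (Sec := Sec)
    (fun t k l hl hkl => h.sector k l (by
      by_contra hlB
      exact hl (coeffExt_carrierTrunc_eq_zero h.carrier N t hlB)) hkl)
    (datumTrunc_mem_pvPhase h N)).choose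

/-- The defining properties of the Galerkin coefficient curve. [cite: RobinsonRodrigoSadowski2016, Thm. 4.4 Steps 1–2] -/
theorem PVSetup.galerkinCoeff_spec (h : PVSetup κ b B β C Sec w₀) (N : ℕ) :
    h.galerkinCoeff N 0 = datumTrunc w₀ N ∧ (∀ t, h.galerkinCoeff N t ∈ pvPhase (freqBall N) Sec) ∧
      ContinuousOn (h.galerkinCoeff N) (Ici 0) ∧
      (∀ T, ∀ t ∈ Icc 0 T, HasDerivWithinAt (h.galerkinCoeff N)
        (pvGalerkinRHS (freqBall N) κ (carrierTrunc β N t) (h.galerkinCoeff N t)) (Icc 0 T) t) ∧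
      ∀ t, 0 ≤ t → ∑ k, ‖h.galerkinCoeff N t k‖ ^ 2 ≤ ∑ k, ‖datumTrunc w₀ N k‖ ^ 2 :=
  (exists_pvGalerkin_solution κ h.nonneg (neg_mem_freqBall_of_mem (N := N))
    (continuous_carrierTrunc h.carrier N) (isRealCoeff_carrierTrunc h.carrier N)
    (isSolenoidalCoeff_carrierTrunc h.carrier N) (Sec := Sec)
    (fun t k l hl hkl => h.sector k l (by
      by_contra hlB
      exact hl (coeffExt_carrierTrunc_eq_zero h.carrier N t hlB)) hkl)
    (datumTrunc_mem_pvPhase h N)).choose_spec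

/-- **Bessel for the truncated datum**: `∑_{k∈freqBall N} ‖ŵ₀(k)‖² ≤ ∫‖w₀‖²`. [cite: Grafakos2014, Prop. 3.2.7 (3)] -/
theorem sum_norm_sq_datumTrunc_le (hw₀ : MemLp w₀ 2 volume) (N : ℕ) :
    ∑ k, ‖datumTrunc w₀ N k‖ ^ 2 ≤ ∫ x, ‖w₀ x‖ ^ 2 := by
  have h := sum_le_hasSum (freqBall (d := d) N) (fun k _ => sq_nonneg _)
    (hasSum_sq_norm_mFourierCoeff_complexify hw₀)
  rw [← Finset.sum_coe_sort] at h
  exact h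

/-- **Uniform coefficient-energy bound**: `∑_k ‖α_N t k‖² ≤ ∫‖w₀‖²` for `t ≥ 0`. [cite: RobinsonRodrigoSadowski2016, Thm. 4.4 Step 2 (4.8)] -/
theorem PVSetup.sum_norm_sq_galerkinCoeff_le (h : PVSetup κ b B β C Sec w₀) (N : ℕ) {t : ℝ} (ht : 0 ≤ t) :
    ∑ k, ‖h.galerkinCoeff N t k‖ ^ 2 ≤ ∫ x, ‖w₀ x‖ ^ 2 :=
  ((h.galerkinCoeff_spec N).2.2.2.2 t ht).trans (sum_norm_sq_datumTrunc_le h.memLp N)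

/-- Per-mode bound: `‖α_N t k‖ ≤ (∫‖w₀‖²)^{1/2}`. [cite: RobinsonRodrigoSadowski2016, Thm. 4.4 Step 2 (4.8)] -/
theorem PVSetup.norm_galerkinCoeff_le (h : PVSetup κ b B β C Sec w₀) (N : ℕ) {t : ℝ} (ht : 0 ≤ t)
    (k : ↥(freqBall (d := d) N)) : ‖h.galerkinCoeff N t k‖ ≤ Real.sqrt (∫ x, ‖w₀ x‖ ^ 2) := by
  refine Real.le_sqrt_of_sq_le ?_
  exact (Finset.single_le_sum (f := fun k => ‖h.galerkinCoeff N t k‖ ^ 2) (fun k _ => sq_nonneg _)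
    (Finset.mem_univ k)).trans (h.sum_norm_sq_galerkinCoeff_le N ht)

/-- Sup-norm bound of the state: `‖α_N t‖ ≤ (∫‖w₀‖²)^{1/2}`. [cite: RobinsonRodrigoSadowski2016, Thm. 4.4 Step 2 (4.8)] -/
theorem PVSetup.norm_galerkinCoeff_le' (h : PVSetup κ b B β C Sec w₀) (N : ℕ) {t : ℝ} (ht : 0 ≤ t) :
    ‖h.galerkinCoeff N t‖ ≤ Real.sqrt (∫ x, ‖w₀ x‖ ^ 2) :=
  (pi_norm_le_iff_of_nonneg (Real.sqrt_nonneg _)).2 fun k => h.norm_galerkinCoeff_le N ht k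

/-- **Sector-Poincaré decay of the approximations**: if `R² ≤ |k|²` for every non-zero `k ∈ Sec`, then
`∑_k ‖α_N t k‖² ≤ e^{-8π²κR²t} ∫‖w₀‖²` for `t ≥ 0`. [cite: RobinsonRodrigoSadowski2016, Thm. 4.4 Step 2 (4.8)] -/
theorem PVSetup.sum_norm_sq_galerkinCoeff_le_exp (h : PVSetup κ b B β C Sec w₀) (N : ℕ) {R : ℝ}
    (hR : ∀ k, k ∈ Sec → k ≠ 0 → R ^ 2 ≤ freqNormSq k) {t : ℝ} (ht : 0 ≤ t) :
    ∑ k, ‖h.galerkinCoeff N t k‖ ^ 2 ≤ Real.exp (-(8 * Real.pi ^ 2 * κ * R ^ 2) * t) * ∫ x, ‖w₀ x‖ ^ 2 := by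
  obtain ⟨h0, hmem, -, hsol, -⟩ := h.galerkinCoeff_spec N
  have hvan : ∀ τ ∈ Icc 0 t, ∀ k : ↥(freqBall (d := d) N), freqNormSq (k : d → ℤ) < R ^ 2 →
      h.galerkinCoeff N τ k = 0 := by
    intro τ _ k hk
    refine (hmem τ).2 k ?_
    by_contra hcon
    push Not at hcon
    exact absurd (hR k hcon.1 hcon.2) (not_le.2 hk)
  have hdec := energy_decay_of_solution κ h.nonneg neg_mem_freqBall_of_mem
    (isRealCoeff_carrierTrunc h.carrier N) (isSolenoidalCoeff_carrierTrunc h.carrier N)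
    (hsol t) (fun τ _ => (hmem τ).1) hvan t ⟨ht, le_rfl⟩
  rw [h0] at hdec
  exact hdec.trans (mul_le_mul_of_nonneg_left (sum_norm_sq_datumTrunc_le h.memLp N) (Real.exp_pos _).le)

end Scheme

/-! ## §2 Equi-Lipschitz estimate for the Fourier modes -/

section Equicontinuity

variable {b : ℝ → UnitAddTorus d → EuclideanSpace ℝ d} {B : Finset (d → ℤ)}
  {β : ℝ → (d → ℤ) → EuclideanSpace ℂ d} {C κ : ℝ} {Sec : Set (d → ℤ)}
  {w₀ : UnitAddTorus d → EuclideanSpace ℝ d}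

/-- The `ℓ¹` weight of a frequency, `∑ⱼ |kⱼ|`. [cite: RobinsonRodrigoSadowski2016, Ex. 4.2] -/
def freqWeight₁ (k : d → ℤ) : ℝ := ∑ j, |((k j : ℤ) : ℝ)|

omit [DecidableEq d] in
/-- The weight is nonnegative. [cite: RobinsonRodrigoSadowski2016, Ex. 4.2] -/
theorem freqWeight₁_nonneg (k : d → ℤ) : 0 ≤ freqWeight₁ k := Finset.sum_nonneg fun _ _ => abs_nonneg _

omit [DecidableEq d] in
/-- **Per-mode bound of the truncated transport term**: if the carrier coefficients `βe` are bounded by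
`Cb` and vanish off `B`, and the state coefficients are bounded by `M` in sup norm, then
`‖convectionCoeff S βe c k‖ ≤ 2π Cb M ∑_{l∈B} |k - l|₁` — mode `k` is fed only by the modes `k - l`,
`l ∈ B`. [cite: RobinsonRodrigoSadowski2016, Ex. 4.2] -/
theorem norm_convectionCoeff_apply_le_of_support {S : Finset (d → ℤ)} {βe c : (d → ℤ) → EuclideanSpace ℂ d}
    {Cb M : ℝ} (hCb : 0 ≤ Cb) (hM : 0 ≤ M) (hβ : ∀ l, ‖βe l‖ ≤ Cb) (hβB : ∀ l, l ∉ B → βe l = 0)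
    (hc : ∀ m, ‖c m‖ ≤ M) (k : d → ℤ) :
    ‖convectionCoeff S βe c k‖ ≤ 2 * Real.pi * Cb * M * ∑ l ∈ B, freqWeight₁ (k - l) := by
  classical
  rw [convectionCoeff_def]
  -- bound each `l`-term
  have hterm : ∀ l ∈ S, ‖∑ m ∈ S, (if l + m = k then
      (2 * Real.pi * Complex.I * ∑ j, βe l j * (m j : ℂ)) • c m else 0)‖ ≤
      if l ∈ B then 2 * Real.pi * Cb * M * freqWeight₁ (k - l) else 0 := by
    intro l _
    by_cases hlB : l ∈ B
    · rw [if_pos hlB]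
      -- at most the term `m = k - l` survives
      have hsum : ∑ m ∈ S, (if l + m = k then (2 * Real.pi * Complex.I * ∑ j, βe l j * (m j : ℂ)) • c m else 0) =
          if k - l ∈ S then (2 * Real.pi * Complex.I * ∑ j, βe l j * ((k - l) j : ℂ)) • c (k - l) else 0 := by
        have hiff : ∀ m, (l + m = k) ↔ (m = k - l) := fun m =>
          ⟨fun hm => by rw [← hm]; abel, fun hm => by rw [hm]; abel⟩
        simp_rw [hiff]
        rw [Finset.sum_ite_eq' S (k - l)]
      rw [hsum]
      split_ifs with hkl
      · rw [norm_smul]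
        have hS : ‖∑ j, βe l j * ((k - l) j : ℂ)‖ ≤ Cb * freqWeight₁ (k - l) := by
          rw [freqWeight₁, Finset.mul_sum]
          refine (norm_sum_le (Finset.univ : Finset d) fun j => βe l j * ((k - l) j : ℂ)).trans
            (Finset.sum_le_sum fun j _ => ?_)
          rw [norm_mul, Complex.norm_intCast]
          exact mul_le_mul_of_nonneg_right ((PiLp.norm_apply_le (βe l) j).trans (hβ l)) (abs_nonneg _)
        have h2π : ‖(2 * Real.pi * Complex.I : ℂ)‖ = 2 * Real.pi := by
          simp [Complex.norm_real, abs_of_nonneg Real.pi_pos.le]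
        have hin : ‖2 * Real.pi * Complex.I * ∑ j, βe l j * ((k - l) j : ℂ)‖ ≤ 2 * Real.pi * Cb * freqWeight₁ (k - l) := by
          rw [norm_mul, h2π, mul_assoc (2 * Real.pi)]
          exact mul_le_mul_of_nonneg_left hS (by positivity)
        calc ‖2 * Real.pi * Complex.I * ∑ j, βe l j * ((k - l) j : ℂ)‖ * ‖c (k - l)‖
            ≤ (2 * Real.pi * Cb * freqWeight₁ (k - l)) * M :=
              mul_le_mul hin (hc _) (norm_nonneg _) (by have := freqWeight₁_nonneg (k - l); positivity)
          _ = 2 * Real.pi * Cb * M * freqWeight₁ (k - l) := by ring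
      · rw [norm_zero]; have := freqWeight₁_nonneg (k - l); positivity
    · rw [if_neg hlB]
      have h0 : ∀ m ∈ S, (if l + m = k then (2 * Real.pi * Complex.I * ∑ j, βe l j * (m j : ℂ)) • c m else 0) = 0 := by
        intro m _
        split_ifs
        · rw [hβB l hlB]; simp
        · rfl
      rw [Finset.sum_congr rfl h0, Finset.sum_const_zero, norm_zero]
  refine (norm_sum_le _ _).trans ((Finset.sum_le_sum hterm).trans ?_)
  rw [Finset.mul_sum]
  -- `∑_{l∈S} 1_{l∈B} f l ≤ ∑_{l∈B} f l`
  rw [← Finset.sum_filter]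
  refine Finset.sum_le_sum_of_subset_of_nonneg (fun l hl => (Finset.mem_filter.1 hl).2) fun l _ _ => ?_
  have := freqWeight₁_nonneg (k - l); positivity

/-- The equi-Lipschitz constant of the `k`-th mode: `(κ 4π²|k|² + 2π C⁺ ∑_{l∈B} |k-l|₁) (∫‖w₀‖²)^{1/2}`,
`C⁺ = max C 0`. [cite: RobinsonRodrigoSadowski2016, Ex. 4.2] -/
def modeLip (κ : ℝ) (B : Finset (d → ℤ)) (C : ℝ) (w₀ : UnitAddTorus d → EuclideanSpace ℝ d) (k : d → ℤ) : ℝ :=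
  (κ * (4 * Real.pi ^ 2 * freqNormSq k) + 2 * Real.pi * max C 0 * ∑ l ∈ B, freqWeight₁ (k - l)) *
    Real.sqrt (∫ x, ‖w₀ x‖ ^ 2)

omit [DecidableEq d] in
/-- The equi-Lipschitz constant is nonnegative for `κ ≥ 0`. [cite: RobinsonRodrigoSadowski2016, Ex. 4.2] -/
theorem modeLip_nonneg (hκ : 0 ≤ κ) (k : d → ℤ) : 0 ≤ modeLip κ B C w₀ k := by
  unfold modeLip
  have h1 := freqNormSq_nonneg k
  have h2 : 0 ≤ ∑ l ∈ B, freqWeight₁ (k - l) := Finset.sum_nonneg fun l _ => freqWeight₁_nonneg _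
  have h3 : 0 ≤ max C 0 := le_max_right _ _
  positivity

/-- **Uniform bound on the time derivative of each mode**: for `t ≥ 0` and `k ∈ freqBall N`,
`‖V(β_N(t), α_N(t))_k‖ ≤ modeLip κ B C w₀ k`. [cite: RobinsonRodrigoSadowski2016, Ex. 4.2] -/
theorem PVSetup.norm_rhs_galerkinCoeff_le (h : PVSetup κ b B β C Sec w₀) (N : ℕ) {t : ℝ} (ht : 0 ≤ t)
    (k : ↥(freqBall (d := d) N)) :
    ‖pvGalerkinRHS (freqBall N) κ (carrierTrunc β N t) (h.galerkinCoeff N t) k‖ ≤ modeLip κ B C w₀ (k : d → ℤ) := by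
  have hM0 : 0 ≤ Real.sqrt (∫ x, ‖w₀ x‖ ^ 2) := Real.sqrt_nonneg _
  have hcm : ∀ m, ‖coeffExt (freqBall N) (h.galerkinCoeff N t) m‖ ≤ Real.sqrt (∫ x, ‖w₀ x‖ ^ 2) := fun m =>
    (norm_coeffExt_le _ m).trans (h.norm_galerkinCoeff_le' N ht)
  have hβl : ∀ l, ‖coeffExt (freqBall N) (carrierTrunc β N t) l‖ ≤ max C 0 := fun l =>
    (norm_coeffExt_le _ l).trans (norm_carrierTrunc_le h.carrier N t)
  rw [pvGalerkinRHS_apply, pvGalerkinField_def]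
  refine (norm_sub_le _ _).trans ?_
  have h1 : ‖-(((κ * (4 * Real.pi ^ 2 * freqNormSq (k : d → ℤ)) : ℝ) : ℂ) •
      coeffExt (freqBall N) (h.galerkinCoeff N t) k)‖ ≤
      κ * (4 * Real.pi ^ 2 * freqNormSq (k : d → ℤ)) * Real.sqrt (∫ x, ‖w₀ x‖ ^ 2) := by
    rw [norm_neg, norm_smul, Complex.norm_real, Real.norm_of_nonneg (by
      have := freqNormSq_nonneg (k : d → ℤ); have := h.nonneg; positivity)]
    exact mul_le_mul_of_nonneg_left (hcm k) (by have := freqNormSq_nonneg (k : d → ℤ); have := h.nonneg; positivity)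
  have h2 : ‖leraySym (k : d → ℤ) (convectionCoeff (freqBall N) (coeffExt (freqBall N) (carrierTrunc β N t))
      (coeffExt (freqBall N) (h.galerkinCoeff N t)) k)‖ ≤
      2 * Real.pi * max C 0 * Real.sqrt (∫ x, ‖w₀ x‖ ^ 2) * ∑ l ∈ B, freqWeight₁ ((k : d → ℤ) - l) :=
    (norm_leraySym_le _ _).trans (norm_convectionCoeff_apply_le_of_support (le_max_right _ _) hM0 hβl
      (fun l hl => coeffExt_carrierTrunc_eq_zero h.carrier N t hl) hcm (k : d → ℤ))
  calc _ ≤ κ * (4 * Real.pi ^ 2 * freqNormSq (k : d → ℤ)) * Real.sqrt (∫ x, ‖w₀ x‖ ^ 2) +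
        2 * Real.pi * max C 0 * Real.sqrt (∫ x, ‖w₀ x‖ ^ 2) * ∑ l ∈ B, freqWeight₁ ((k : d → ℤ) - l) :=
        add_le_add h1 h2
    _ = modeLip κ B C w₀ (k : d → ℤ) := by rw [modeLip]; ring

/-- **Equi-Lipschitz bound for the Galerkin modes** (mean value inequality): for `k ∈ freqBall N` and
`s, t ∈ [0, T]`, `‖α_N(t)_k - α_N(s)_k‖ ≤ modeLip κ B C w₀ k · |t - s|`. [cite: RobinsonRodrigoSadowski2016, Ex. 4.2] -/
theorem PVSetup.norm_galerkinCoeff_sub_le (h : PVSetup κ b B β C Sec w₀) (N : ℕ) {T s t : ℝ}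
    (hs : s ∈ Icc 0 T) (ht : t ∈ Icc 0 T) (k : ↥(freqBall (d := d) N)) :
    ‖h.galerkinCoeff N t k - h.galerkinCoeff N s k‖ ≤ modeLip κ B C w₀ (k : d → ℤ) * |t - s| := by
  obtain ⟨-, -, -, hsol, -⟩ := h.galerkinCoeff_spec N
  have hk : ∀ τ ∈ Icc 0 T, HasDerivWithinAt (fun τ => h.galerkinCoeff N τ k)
      (pvGalerkinRHS (freqBall N) κ (carrierTrunc β N τ) (h.galerkinCoeff N τ) k) (Icc 0 T) τ := fun τ hτ =>
    (ContinuousLinearMap.proj (R := ℝ) (φ := fun _ : ↥(freqBall (d := d) N) => EuclideanSpace ℂ d) k).hasFDerivAt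
      |>.comp_hasDerivWithinAt τ (hsol T τ hτ)
  have hmv := Convex.norm_image_sub_le_of_norm_hasDerivWithin_le hk
    (fun τ hτ => h.norm_rhs_galerkinCoeff_le N hτ.1 k) (convex_Icc 0 T) hs ht
  rwa [Real.norm_eq_abs] at hmv

/-- **The Fourier coefficients of the approximations**, extended by zero off the ball. [cite: RobinsonRodrigoSadowski2016, Thm. 4.11] -/
def PVSetup.galerkinCoeffAt (h : PVSetup κ b B β C Sec w₀) (N : ℕ) (t : ℝ) (k : d → ℤ) : EuclideanSpace ℂ d :=
  coeffExt (freqBall N) (h.galerkinCoeff N t) k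

/-- **The Galerkin approximation of order `N`**: `u_N(t) = realTrigPoly (freqBall N) (α_N t)`. [cite: RobinsonRodrigoSadowski2016, Thm. 4.4 Step 1 (4.3)] -/
def PVSetup.galerkinApprox (h : PVSetup κ b B β C Sec w₀) (N : ℕ) (t : ℝ) : UnitAddTorus d → EuclideanSpace ℝ d :=
  realTrigPoly (freqBall N) (h.galerkinCoeffAt N t)

/-- The extended coefficients are conjugate symmetric. [cite: ConstantinFoias1988, Ch. 8 (8.3)–(8.5)] -/
theorem PVSetup.isConjSymm_galerkinCoeffAt (h : PVSetup κ b B β C Sec w₀) (N : ℕ) (t : ℝ) :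
    IsConjSymm (h.galerkinCoeffAt N t) :=
  ((h.galerkinCoeff_spec N).2.1 t).1.1.isConjSymm_coeffExt neg_mem_freqBall_of_mem

/-- The extended coefficients are transversal everywhere. [cite: ConstantinFoias1988, Ch. 8 (8.3)–(8.5)] -/
theorem PVSetup.sum_mul_galerkinCoeffAt (h : PVSetup κ b B β C Sec w₀) (N : ℕ) (t : ℝ) (k : d → ℤ) :
    ∑ j, (k j : ℂ) * h.galerkinCoeffAt N t k j = 0 := by
  by_cases hk : k ∈ freqBall N
  · rw [PVSetup.galerkinCoeffAt, coeffExt_of_mem _ hk]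
    exact ((h.galerkinCoeff_spec N).2.1 t).1.2 ⟨k, hk⟩
  · rw [PVSetup.galerkinCoeffAt, coeffExt_of_not_mem _ hk]; simp

/-- The extended coefficients vanish off the sector and at the zero mode. [cite: ConstantinFoias1988, Ch. 8 (8.3)–(8.5)] -/
theorem PVSetup.galerkinCoeffAt_eq_zero (h : PVSetup κ b B β C Sec w₀) (N : ℕ) (t : ℝ) {k : d → ℤ}
    (hk : k ∉ Sec ∨ k = 0) : h.galerkinCoeffAt N t k = 0 := by
  by_cases hkS : k ∈ freqBall N
  · rw [PVSetup.galerkinCoeffAt, coeffExt_of_mem _ hkS]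
    exact ((h.galerkinCoeff_spec N).2.1 t).2 ⟨k, hkS⟩ hk
  · rw [PVSetup.galerkinCoeffAt, coeffExt_of_not_mem _ hkS]

/-- `galerkinCoeffAt` is the Fourier coefficient family of the approximation. [cite: Grafakos2014, Prop. 3.2.7 (3)] -/
theorem PVSetup.mFourierCoeff_galerkinApprox (h : PVSetup κ b B β C Sec w₀) (N : ℕ) (t : ℝ) (k : d → ℤ) :
    mFourierCoeff (EuclideanSpace.complexify ∘ h.galerkinApprox N t) k = h.galerkinCoeffAt N t k := by
  rw [PVSetup.galerkinApprox, mFourierCoeff_realTrigPoly neg_mem_freqBall_of_mem (h.isConjSymm_galerkinCoeffAt N t)]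
  by_cases hk : k ∈ freqBall N
  · rw [if_pos hk]
  · rw [if_neg hk, PVSetup.galerkinCoeffAt, coeffExt_of_not_mem _ hk]

/-- **Uniform bound**: `‖α_N(t)(k)‖ ≤ (∫‖w₀‖²)^{1/2}` for `t ≥ 0`, every `k`. [cite: RobinsonRodrigoSadowski2016, Thm. 4.4 Step 2 (4.8)] -/
theorem PVSetup.norm_galerkinCoeffAt_le (h : PVSetup κ b B β C Sec w₀) (N : ℕ) {t : ℝ} (ht : 0 ≤ t) (k : d → ℤ) :
    ‖h.galerkinCoeffAt N t k‖ ≤ Real.sqrt (∫ x, ‖w₀ x‖ ^ 2) :=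
  (norm_coeffExt_le _ k).trans (h.norm_galerkinCoeff_le' N ht)

/-- **Finite energy bounds with decay**: for every finite `F ⊆ ℤ^d` and `t ≥ 0`,
`∑_{k∈F} ‖α_N(t)(k)‖² ≤ e^{-8π²κR²t} ∫‖w₀‖²` when `R² ≤ |k|²` on `Sec ∖ {0}`. [cite: RobinsonRodrigoSadowski2016, Thm. 4.4 Step 2 (4.8)] -/
theorem PVSetup.sum_norm_sq_galerkinCoeffAt_le (h : PVSetup κ b B β C Sec w₀) (N : ℕ) {R : ℝ}
    (hR : ∀ k, k ∈ Sec → k ≠ 0 → R ^ 2 ≤ freqNormSq k) {t : ℝ} (ht : 0 ≤ t) (F : Finset (d → ℤ)) :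
    ∑ k ∈ F, ‖h.galerkinCoeffAt N t k‖ ^ 2 ≤ Real.exp (-(8 * Real.pi ^ 2 * κ * R ^ 2) * t) * ∫ x, ‖w₀ x‖ ^ 2 := by
  classical
  -- only the frequencies in the ball contribute, and they are a sub-family of the full coefficient sum
  have hsplit : ∑ k ∈ F, ‖h.galerkinCoeffAt N t k‖ ^ 2 = ∑ k ∈ F ∩ freqBall N, ‖h.galerkinCoeffAt N t k‖ ^ 2 := by
    refine (Finset.sum_subset Finset.inter_subset_left fun k hkF hk => ?_).symm
    have hkS : k ∉ freqBall N := fun hkS => hk (Finset.mem_inter.2 ⟨hkF, hkS⟩)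
    rw [PVSetup.galerkinCoeffAt, coeffExt_of_not_mem _ hkS]; simp
  rw [hsplit]
  calc ∑ k ∈ F ∩ freqBall N, ‖h.galerkinCoeffAt N t k‖ ^ 2
      ≤ ∑ k ∈ freqBall N, ‖h.galerkinCoeffAt N t k‖ ^ 2 :=
        Finset.sum_le_sum_of_subset_of_nonneg Finset.inter_subset_right fun k _ _ => sq_nonneg _
    _ = ∑ k, ‖h.galerkinCoeff N t k‖ ^ 2 := by
        rw [← Finset.sum_coe_sort]
        exact Finset.sum_congr rfl fun k _ => by rw [PVSetup.galerkinCoeffAt, coeffExt_coe]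
    _ ≤ _ := h.sum_norm_sq_galerkinCoeff_le_exp N hR ht

end Equicontinuity

/-! ## §3 Diagonal extraction -/

section Extraction

variable {b : ℝ → UnitAddTorus d → EuclideanSpace ℝ d} {B : Finset (d → ℤ)}
  {β : ℝ → (d → ℤ) → EuclideanSpace ℂ d} {C κ : ℝ} {Sec : Set (d → ℤ)}
  {w₀ : UnitAddTorus d → EuclideanSpace ℝ d}

/-- **Diagonal extraction.** Along a subsequence `φ`, the Fourier modes `α_{φ n}(t)(k)` of the Galerkin
approximations converge for every frequency `k` and every time `t ≥ 0` (countably many bounded sequences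
at the nonnegative rational times, Tychonoff; then all times by the equi-Lipschitz estimate), to limits
`c t k` inheriting the uniform bound, the finite energy bounds with decay, the Lipschitz continuity in
time, conjugate symmetry, transversality and the sector support (Hopf 1951, §4; Robinson–Rodrigo–Sadowski
2016, Thm. 4.11 and Exercises 4.3–4.4). [cite: RobinsonRodrigoSadowski2016, Thm. 4.11] -/
theorem PVSetup.exists_subseq_tendsto_galerkinCoeffAt (h : PVSetup κ b B β C Sec w₀) :
    ∃ φ : ℕ → ℕ, StrictMono φ ∧ ∃ c : ℝ → (d → ℤ) → EuclideanSpace ℂ d,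
      (∀ t, 0 ≤ t → ∀ k, Tendsto (fun n => h.galerkinCoeffAt (φ n) t k) atTop (𝓝 (c t k))) ∧
      (∀ R : ℝ, (∀ k, k ∈ Sec → k ≠ 0 → R ^ 2 ≤ freqNormSq k) → ∀ t, 0 ≤ t → ∀ F : Finset (d → ℤ),
        ∑ k ∈ F, ‖c t k‖ ^ 2 ≤ Real.exp (-(8 * Real.pi ^ 2 * κ * R ^ 2) * t) * ∫ x, ‖w₀ x‖ ^ 2) ∧
      (∀ k s t, 0 ≤ s → 0 ≤ t → ‖c t k - c s k‖ ≤ modeLip κ B C w₀ k * |t - s|) ∧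
      (∀ t, 0 ≤ t → IsConjSymm (c t)) ∧
      (∀ t, 0 ≤ t → ∀ k, ∑ j, (k j : ℂ) * c t k j = 0) ∧
      (∀ t, 0 ≤ t → ∀ k, (k ∉ Sec ∨ k = 0) → c t k = 0) := by
  classical
  -- Step 1: the diagonal subsequence at nonnegative rational times
  set ι := (d → ℤ) × {q : ℚ // (0 : ℝ) ≤ q} with hι
  set x : ℕ → ι → EuclideanSpace ℂ d := fun N p => h.galerkinCoeffAt N ((p.2 : ℚ) : ℝ) p.1 with hx
  have hxb : ∀ p : ι, ∃ (z : EuclideanSpace ℂ d) (R : ℝ), ∀ N, x N p ∈ closedBall z R := fun p =>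
    ⟨0, Real.sqrt (∫ x, ‖w₀ x‖ ^ 2), fun N => by
      rw [mem_closedBall, dist_zero_right]
      exact h.norm_galerkinCoeffAt_le N p.2.2 p.1⟩
  obtain ⟨φ, hφ, hlimq⟩ := exists_strictMono_forall_tendsto x hxb
  -- Step 2: convergence at every `t ≥ 0`, frequency by frequency
  have hall : ∀ k, ∀ t ∈ Ici (0 : ℝ), ∃ l, Tendsto (fun n => h.galerkinCoeffAt (φ n) t k) atTop (𝓝 l) := by
    intro k
    refine forall_exists_tendsto_of_subset_closure (x := fun n t => h.galerkinCoeffAt (φ n) t k)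
      Ici_subset_closure_nonneg_rat ?_ ?_
    · rintro _ ⟨q, hq, rfl⟩
      exact hlimq (k, ⟨q, hq⟩)
    · intro ε hε
      have hL : 0 ≤ modeLip κ B C w₀ k := modeLip_nonneg h.nonneg k
      refine ⟨ε / (modeLip κ B C w₀ k + 1), by positivity, fun n t ht s hs hts => ?_⟩
      obtain ⟨q, hq, rfl⟩ := hs
      rw [dist_eq_norm]
      have hmax_t : t ∈ Icc 0 (max t q) := ⟨ht, le_max_left _ _⟩
      have hmax_q : (q : ℝ) ∈ Icc 0 (max t q) := ⟨hq, le_max_right _ _⟩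
      by_cases hkS : k ∈ freqBall (φ n)
      · calc ‖h.galerkinCoeffAt (φ n) t k - h.galerkinCoeffAt (φ n) q k‖
            ≤ modeLip κ B C w₀ k * |t - q| := by
              rw [PVSetup.galerkinCoeffAt, PVSetup.galerkinCoeffAt, coeffExt_of_mem _ hkS, coeffExt_of_mem _ hkS]
              exact h.norm_galerkinCoeff_sub_le (φ n) hmax_q hmax_t ⟨k, hkS⟩
          _ < modeLip κ B C w₀ k * (ε / (modeLip κ B C w₀ k + 1)) + 1 * (ε / (modeLip κ B C w₀ k + 1)) := by
              have h1 : |t - q| < ε / (modeLip κ B C w₀ k + 1) := by rwa [← Real.dist_eq]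
              nlinarith [mul_le_mul_of_nonneg_left h1.le hL, abs_nonneg (t - (q : ℝ))]
          _ = ε := by field_simp
      · rw [PVSetup.galerkinCoeffAt, PVSetup.galerkinCoeffAt, coeffExt_of_not_mem _ hkS, coeffExt_of_not_mem _ hkS,
          sub_zero, norm_zero]
        exact hε
  -- Step 3: the limits and their properties
  choose! c hc using hall
  refine ⟨φ, hφ, fun t k => c k t, fun t ht k => hc k t ht, ?_, ?_, ?_, ?_, ?_⟩
  · intro R hR t ht F
    have hF : Tendsto (fun n => ∑ k ∈ F, ‖h.galerkinCoeffAt (φ n) t k‖ ^ 2) atTop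
        (𝓝 (∑ k ∈ F, ‖c k t‖ ^ 2)) :=
      tendsto_finsetSum F fun k _ => ((hc k t ht).norm).pow 2
    exact le_of_tendsto hF (Eventually.of_forall fun n => h.sum_norm_sq_galerkinCoeffAt_le (φ n) hR ht F)
  · intro k s t hs ht
    have hd := dist_lim_le_of_dist_le (ε := modeLip κ B C w₀ k * |t - s|) (hc k t ht) (hc k s hs) fun n => by
      rw [dist_eq_norm]
      by_cases hkS : k ∈ freqBall (φ n)
      · rw [PVSetup.galerkinCoeffAt, PVSetup.galerkinCoeffAt, coeffExt_of_mem _ hkS, coeffExt_of_mem _ hkS]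
        exact h.norm_galerkinCoeff_sub_le (φ n) (T := max s t) ⟨hs, le_max_left _ _⟩ ⟨ht, le_max_right _ _⟩ ⟨k, hkS⟩
      · rw [PVSetup.galerkinCoeffAt, PVSetup.galerkinCoeffAt, coeffExt_of_not_mem _ hkS, coeffExt_of_not_mem _ hkS,
          sub_zero, norm_zero]
        exact mul_nonneg (modeLip_nonneg h.nonneg k) (abs_nonneg _)
    rwa [dist_eq_norm] at hd
  · intro t ht k
    have h1 : Tendsto (fun n => h.galerkinCoeffAt (φ n) t (-k)) atTop (𝓝 (EuclideanSpace.conjVec (c k t))) := by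
      have hcont : Continuous (EuclideanSpace.conjVec (ι := d)) := (EuclideanSpace.conjVecL (ι := d)).continuous
      have h2 := (hcont.tendsto (c k t)).comp (hc k t ht)
      refine h2.congr fun n => ?_
      simp only [Function.comp_apply]
      exact ((h.isConjSymm_galerkinCoeffAt (φ n) t) k).symm
    exact tendsto_nhds_unique (hc (-k) t ht) h1
  · intro t ht k
    have hcont : Continuous fun v : EuclideanSpace ℂ d => ∑ j, (k j : ℂ) * v j :=
      continuous_finsetSum _ fun j _ => continuous_const.mul (EuclideanSpace.proj j).continuous
    have h1 := (hcont.tendsto (c k t)).comp (hc k t ht)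
    have h2 : ((fun v : EuclideanSpace ℂ d => ∑ j, (k j : ℂ) * v j) ∘ fun n => h.galerkinCoeffAt (φ n) t k) =
        fun _ => 0 := funext fun n => h.sum_mul_galerkinCoeffAt (φ n) t k
    rw [h2] at h1
    exact (tendsto_nhds_unique tendsto_const_nhds h1).symm
  · intro t ht k hk
    have h1 : (fun n => h.galerkinCoeffAt (φ n) t k) = fun _ => 0 :=
      funext fun n => h.galerkinCoeffAt_eq_zero (φ n) t hk
    have h2 := hc k t ht
    rw [h1] at h2
    exact tendsto_nhds_unique h2 tendsto_const_nhds

end Extraction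

/-! ## §4 The limit field -/

section LimitField

variable {b : ℝ → UnitAddTorus d → EuclideanSpace ℝ d} {B : Finset (d → ℤ)}
  {β : ℝ → (d → ℤ) → EuclideanSpace ℂ d} {C κ : ℝ} {Sec : Set (d → ℤ)}
  {w₀ : UnitAddTorus d → EuclideanSpace ℝ d}

/-- **A Galerkin limit** of the passive-vector scheme: a subsequence `φ`, coefficient limits `c` and a
real field `w` with the properties delivered by the extraction and the synthesis: convergence of every
mode at every `t ≥ 0`, finite energy bounds with decay, Lipschitz modes, conjugate symmetry,
transversality, sector support, joint measurability of `w`, `w t ∈ L²` and `𝓕(complexify ∘ w t) = c t` for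
every `t ≥ 0`. [cite: RobinsonRodrigoSadowski2016, Thm. 4.11] -/
structure PVSetup.IsGalerkinLimit (h : PVSetup κ b B β C Sec w₀) (φ : ℕ → ℕ)
    (c : ℝ → (d → ℤ) → EuclideanSpace ℂ d) (w : ℝ → UnitAddTorus d → EuclideanSpace ℝ d) : Prop where
  strictMono : StrictMono φ
  tendsto_coeff : ∀ t, 0 ≤ t → ∀ k, Tendsto (fun n => h.galerkinCoeffAt (φ n) t k) atTop (𝓝 (c t k))
  sum_sq_le : ∀ R : ℝ, (∀ k, k ∈ Sec → k ≠ 0 → R ^ 2 ≤ freqNormSq k) → ∀ t, 0 ≤ t → ∀ F : Finset (d → ℤ),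
    ∑ k ∈ F, ‖c t k‖ ^ 2 ≤ Real.exp (-(8 * Real.pi ^ 2 * κ * R ^ 2) * t) * ∫ x, ‖w₀ x‖ ^ 2
  lip : ∀ k s t, 0 ≤ s → 0 ≤ t → ‖c t k - c s k‖ ≤ modeLip κ B C w₀ k * |t - s|
  conjSymm : ∀ t, 0 ≤ t → IsConjSymm (c t)
  transversal : ∀ t, 0 ≤ t → ∀ k, ∑ j, (k j : ℂ) * c t k j = 0
  support : ∀ t, 0 ≤ t → ∀ k, (k ∉ Sec ∨ k = 0) → c t k = 0
  aestronglyMeasurable : AEStronglyMeasurable (stLift w) (volume.restrict (Ioi 0 ×ˢ univ))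
  memLp : ∀ t, 0 ≤ t → MemLp (w t) 2 volume
  coeff_eq : ∀ t, 0 ≤ t → ∀ k, mFourierCoeff (EuclideanSpace.complexify ∘ w t) k = c t k

/-- **Galerkin limits exist** (diagonal extraction + parametrised Riesz–Fischer synthesis). [cite: RobinsonRodrigoSadowski2016, Thm. 4.11] -/
theorem PVSetup.exists_isGalerkinLimit (h : PVSetup κ b B β C Sec w₀) :
    ∃ φ c w, h.IsGalerkinLimit φ c w := by
  obtain ⟨φ, hφ, c, hconv, hsum, hlip, hsymm, htrans, hsupp⟩ := h.exists_subseq_tendsto_galerkinCoeffAt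
  -- hypotheses of the parametrised Riesz–Fischer theorem
  have hmeas : ∀ k, AEStronglyMeasurable (fun t => c t k) (volume.restrict (Ioi 0)) := by
    intro k
    have hL : LipschitzOnWith (Real.toNNReal (modeLip κ B C w₀ k)) (fun t => c t k) (Ici 0) := by
      refine LipschitzOnWith.of_dist_le_mul fun t ht s hs => ?_
      rw [dist_eq_norm, Real.dist_eq]
      exact (hlip k s t hs ht).trans (mul_le_mul_of_nonneg_right (Real.le_coe_toNNReal _) (abs_nonneg _))
    exact (hL.continuousOn.mono Ioi_subset_Ici_self).aestronglyMeasurable measurableSet_Ioi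
  have hbound : ∀ T : ℝ, ∃ K : ℝ≥0∞, K ≠ ⊤ ∧ ∀ t ∈ Icc 0 T, ∑' k, ‖c t k‖ₑ ^ 2 ≤ K := by
    intro T
    refine ⟨ENNReal.ofReal (∫ x, ‖w₀ x‖ ^ 2), ENNReal.ofReal_ne_top, fun t ht => ?_⟩
    refine ENNReal.summable.tsum_le_of_sum_le fun F => ?_
    have h1 : ∑ k ∈ F, ‖c t k‖ₑ ^ 2 = ENNReal.ofReal (∑ k ∈ F, ‖c t k‖ ^ 2) := by
      rw [ENNReal.ofReal_sum_of_nonneg fun k _ => sq_nonneg _]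
      refine Finset.sum_congr rfl fun k _ => ?_
      rw [← ofReal_norm, ENNReal.ofReal_pow (norm_nonneg _)]
    rw [h1]
    refine ENNReal.ofReal_le_ofReal ?_
    have h0 := hsum 0 (fun k _ _ => by rw [sq, zero_mul]; exact freqNormSq_nonneg k) t ht.1 F
    simpa using h0
  obtain ⟨u, hum, hu⟩ := exists_realField_forall_mFourierCoeff_eq hmeas hbound hsymm
  exact ⟨φ, c, u, ⟨hφ, hconv, hsum, hlip, hsymm, htrans, hsupp, hum, fun t ht => (hu t ht).1,
    fun t ht => (hu t ht).2⟩⟩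

namespace PVSetup.IsGalerkinLimit

variable {h : PVSetup κ b B β C Sec w₀} {φ : ℕ → ℕ} {c : ℝ → (d → ℤ) → EuclideanSpace ℂ d}
  {w : ℝ → UnitAddTorus d → EuclideanSpace ℝ d}

/-- **`L²` bound and decay of the limit**: `∫‖w(t)‖² ≤ e^{-8π²κR²t} ∫‖w₀‖²` for `t ≥ 0` whenever `R² ≤ |k|²`
on `Sec ∖ {0}` (Parseval and the finite energy bounds of the limiting coefficients); `R = 0` gives the
plain bound. [cite: RobinsonRodrigoSadowski2016, Thm. 4.6] -/
theorem integral_norm_sq_le (hl : h.IsGalerkinLimit φ c w) {R : ℝ}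
    (hR : ∀ k, k ∈ Sec → k ≠ 0 → R ^ 2 ≤ freqNormSq k) {t : ℝ} (ht : 0 ≤ t) :
    ∫ x, ‖w t x‖ ^ 2 ≤ Real.exp (-(8 * Real.pi ^ 2 * κ * R ^ 2) * t) * ∫ x, ‖w₀ x‖ ^ 2 := by
  have hP := hasSum_sq_norm_mFourierCoeff_complexify (hl.memLp t ht)
  simp_rw [hl.coeff_eq t ht] at hP
  rw [← hP.tsum_eq]
  exact hP.summable.tsum_le_of_sum_le (hl.sum_sq_le R hR t ht)

/-- **Sector support of the limit**: for `t ≥ 0` the slice `w t` is Fourier-supported in `Sec` (and has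
zero mean mode). [cite: RobinsonRodrigoSadowski2016, Thm. 4.11] -/
theorem mFourierCoeff_eq_zero (hl : h.IsGalerkinLimit φ c w) {t : ℝ} (ht : 0 ≤ t) {k : d → ℤ}
    (hk : k ∉ Sec ∨ k = 0) : mFourierCoeff (EuclideanSpace.complexify ∘ w t) k = 0 := by
  rw [hl.coeff_eq t ht k]; exact hl.support t ht k hk

/-- **Every slice of the limit is weakly divergence free** (transversal coefficients,
`Torus.isWeaklyDivFree_of_sum_mul_mFourierCoeff_eq_zero`). [cite: RobinsonRodrigoSadowski2016, Lemma 2.3] -/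
theorem isWeaklyDivFree (hl : h.IsGalerkinLimit φ c w) {t : ℝ} (ht : 0 ≤ t) :
    FunctionSpaces.Torus.IsWeaklyDivFree (w t) :=
  Torus.isWeaklyDivFree_of_sum_mul_mFourierCoeff_eq_zero (hl.memLp t ht) fun k => by
    rw [hl.coeff_eq t ht k]; exact hl.transversal t ht k

end PVSetup.IsGalerkinLimit

end LimitField

end Torus

end Literature.Analysis.FluidPDE
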